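import Literature.RingTheory.Flat.FiniteRegularFree
import Literature.RingTheory.Depth.CohenMacaulayGradeCodimension
import Literature.AlgebraicGeometry.Resolution.FlatSlicingCriterion
import HarnessLib

/-!
# A Cohen–Macaulay local ring over a regular local ring of the same dimension with zero-dimensional fibre is flat
# (Matsumura Thm. 23.1 with a Cohen–Macaulay source; EGA IV₂ 6.1.5; the local step of [Lan2013, Lem. 6.3.1.11])

Topic `Literature/RingTheory/Flat`; namespace `Literature.RingTheory.Flat`.  THEOREMS ONLY (no definition, no named fact, no
`sorry`, no axiom, no instance).  Sequel of ★ `FiniteRegularFree` (`flat_of_isRegular_map_of_ofList_eq_maximalIdeal`: a local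
homomorphism `A → B` of Noetherian local rings is flat as soon as `𝔪_A` is generated by a list mapping to a `B`-regular sequence;
`flat_of_isRegularLocalRing_of_maximalIdeal_pow_le`: the REGULAR-source case of Thm. 23.1), which this file extends to a
COHEN–MACAULAY source using ★ `Depth.CohenMacaulayGradeCodimension` (Bruns–Herzog Thm. 2.1.2 (d): every system of parameters
of a Cohen–Macaulay module is a regular sequence) and ★ `KrullDimension.SystemOfParameters`.

* `supportDim_quotient_eq_zero_of_maximalIdeal_pow_le` — for an ideal `J` of a Noetherian local ring with `𝔪ᴺ ⊆ J ⊆ 𝔪`,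
  `dim S/J = 0` (in Mathlib's `Module.supportDim`), i.e. `J` is `𝔪`-primary.
* `isSystemOfParametersOf_map_of_maximalIdeal_pow_le` — along a local homomorphism `R → S` of Noetherian local rings of the
  same dimension with `𝔪_Sᴺ ⊆ 𝔪_R S`, any list generating `𝔪_R` of length `dim R` maps to a system of parameters of `S`.
* `flat_of_isCohenMacaulayLocalRing_of_maximalIdeal_pow_le` — **Matsumura 23.1, fibre-dimension-zero case**: `R` regular
  local, `S` Cohen–Macaulay local, `R → S` local with `dim S = dim R` and `𝔪_Sᴺ ⊆ 𝔪_R S` for some `N` (⟺ `dim S/𝔪_R S = 0`,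
  so that `dim S = dim R + dim S/𝔪_R S`) ⇒ `S` is flat over `R`.  Proof as printed: a regular system of parameters `x₁,…,x_d`
  of `R` maps to a system of parameters of `S` (same dimension, `𝔪_R S` is `𝔪_S`-primary), hence — `S` being Cohen–Macaulay —
  to an `S`-regular sequence (Thm. 17.4 (iii)), and then `S` is flat over `R` by the slicing induction of 23.1.
  This is the local algebra behind [Lan2013PELCompactifications, Lem. 6.3.1.11] («`f` quasi-finite, `Z₁` Cohen–Macaulay,
  `Z₂` regular ⇒ `f` flat», via [EGA IV₃ 15.4.2 e′)⇒b)]); the stalkwise scheme form is `AlgebraicGeometry/Morphisms/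
  FlatOfCohenMacaulayStalks`.

## References
* [Matsumura1987] H. Matsumura, *Commutative Ring Theory*, CUP 1986, Thm. 23.1 (with Thm. 17.4 (iii)).
* [BrunsHerzog1998] W. Bruns, J. Herzog, *Cohen–Macaulay rings*, rev. ed., CUP 1998, Thm. 2.1.2 (d), Appendix p. 413.
* [Lan2013PELCompactifications] K.-W. Lan, *Arithmetic compactifications of PEL-type Shimura varieties*, Lem. 6.3.1.11 (p. 417).
-/

namespace Literature.RingTheory.Flat

open IsLocalRing Module RingTheory.Sequence Ideal
open Literature.AlgebraicGeometry.Resolution Literature.RingTheory.KrullDimension Literature.RingTheory.Depth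

universe u

variable {R S : Type u} [CommRing R] [CommRing S]

/-- **An `𝔪`-primary ideal has zero-dimensional quotient**: if `S` is Noetherian local and `𝔪ᴺ ⊆ J` with `J ≠ S`, then
`dim_S (S/J) = 0` (`S/J` is Artinian with the single prime `𝔪/J`). [cite: BrunsHerzog1998, Appendix p. 413] -/
theorem supportDim_quotient_eq_zero_of_maximalIdeal_pow_le [IsNoetherianRing S] [IsLocalRing S] {J : Ideal S} {N : ℕ}
    (hN : maximalIdeal S ^ N ≤ J) (hJ : J ≠ ⊤) : supportDim S (S ⧸ J) = 0 := by
  haveI : Nontrivial (S ⧸ J) := Ideal.Quotient.nontrivial_iff.mpr hJ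
  have hfl : IsFiniteLength S (S ⧸ J) := Matsumura1987.isFiniteLength_quotient_of_pow_le hN
  rw [isFiniteLength_iff_isNoetherian_isArtinian] at hfl
  haveI : IsArtinianRing (S ⧸ J) := isArtinian_of_tower S hfl.2
  have h0 : Ring.KrullDimLE 0 (S ⧸ J) := (isArtinianRing_iff_isNoetherianRing_krullDimLE_zero.mp inferInstance).2
  rw [Module.supportDim_quotient_eq_ringKrullDim]
  refine le_antisymm ?_ ringKrullDim_nonneg_of_nontrivial
  exact_mod_cast (Ring.krullDimLE_iff.mp h0)

/-- **A generating list of `𝔪_R` maps to a system of parameters of `S`** along a local homomorphism `R → S` of Noetherian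
local rings with `dim S = dim R` and `𝔪_Sᴺ ⊆ 𝔪_R S` («`x₁, …, x_d` is a system of parameters of `S`», the first step of the
proof of Thm. 23.1 in the fibre-dimension-zero case). [cite: Matsumura1987, Thm. 23.1 (proof)] -/
theorem isSystemOfParametersOf_map_of_maximalIdeal_pow_le [IsNoetherianRing R] [IsLocalRing R] [IsNoetherianRing S]
    [IsLocalRing S] [Algebra R S] [IsLocalHom (algebraMap R S)] {rs : List R}
    (hspan : Ideal.ofList rs = maximalIdeal R) (hlen : (rs.length : WithBot ℕ∞) = ringKrullDim R)
    (hdim : ringKrullDim S = ringKrullDim R) {N : ℕ} (hN : maximalIdeal S ^ N ≤ (maximalIdeal R).map (algebraMap R S)) :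
    IsSystemOfParametersOf S (rs.map (algebraMap R S)) := by
  have hQspan : Ideal.ofList (rs.map (algebraMap R S)) = (maximalIdeal R).map (algebraMap R S) := by
    rw [← Ideal.map_ofList, hspan]
  have hQm : ∀ q ∈ rs.map (algebraMap R S), q ∈ maximalIdeal S := by
    intro q hq
    obtain ⟨r, hr, rfl⟩ := List.mem_map.mp hq
    exact map_nonunit (algebraMap R S) r (hspan ▸ Ideal.subset_span (by simpa using hr))
  have hle : Ideal.ofList (rs.map (algebraMap R S)) ≤ maximalIdeal S := by
    rw [Ideal.ofList, Ideal.span_le]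
    rintro q hq
    exact hQm q (by simpa using hq)
  refine ⟨hQm, ?_, ?_⟩
  · rw [List.length_map, hlen, ← hdim, Module.supportDim_self_eq_ringKrullDim]
  · have hI : (Ideal.ofList (rs.map (algebraMap R S)) • ⊤ : Submodule S S) = Ideal.ofList (rs.map (algebraMap R S)) := by
      rw [Ideal.smul_eq_mul, Ideal.mul_top]
    rw [hI]
    refine supportDim_quotient_eq_zero_of_maximalIdeal_pow_le (N := N) (hQspan ▸ hN) ?_
    exact fun h => (maximalIdeal.isMaximal S).ne_top (top_le_iff.mp (h ▸ hle))

/-- **Matsumura, Thm. 23.1 (Cohen–Macaulay source, zero-dimensional fibre).**  Let `R → S` be a local homomorphism of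
Noetherian local rings with `R` regular and `S` Cohen–Macaulay, `dim S = dim R`, and `𝔪_Sᴺ ⊆ 𝔪_R S` for some `N` (the fibre
`S/𝔪_R S` is zero-dimensional, so `dim S = dim R + dim S/𝔪_R S`).  Then `S` is flat over `R`: a regular system of parameters of
`R` maps to a system of parameters of `S`, which is an `S`-sequence because `S` is Cohen–Macaulay (Thm. 17.4 (iii) = [BrunsHerzog1998,
Thm. 2.1.2 (d)]), and flatness follows by the induction of the printed proof (★ `flat_of_isRegular_map_of_ofList_eq_maximalIdeal`).
[cite: Matsumura1987, Thm. 23.1] -/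
theorem flat_of_isCohenMacaulayLocalRing_of_maximalIdeal_pow_le [IsRegularLocalRing R] [IsNoetherianRing S] [IsLocalRing S]
    [Algebra R S] [IsLocalHom (algebraMap R S)] (hS : IsCohenMacaulayLocalRing S)
    (hdim : ringKrullDim S = ringKrullDim R)
    (hprim : ∃ N : ℕ, maximalIdeal S ^ N ≤ (maximalIdeal R).map (algebraMap R S)) :
    Module.Flat R S := by
  obtain ⟨rs, -, hspan, hlen⟩ := exists_isRegular_ofList_eq_maximalIdeal (R := R)
  obtain ⟨N, hN⟩ := hprim
  have hsop : IsSystemOfParametersOf S (rs.map (algebraMap R S)) :=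
    isSystemOfParametersOf_map_of_maximalIdeal_pow_le hspan hlen hdim hN
  have hreg : IsRegular S (rs.map (algebraMap R S)) :=
    IsCohenMacaulayModule.isRegular_of_isSystemOfParametersOf S hS hsop
  exact flat_of_isRegular_map_of_ofList_eq_maximalIdeal rs.length rs rfl hspan hreg

end Literature.RingTheory.Flat
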